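import Summits.AtomisticToContinuum.HydrodynamicLimit.Theorems.RelayRaceLocalityLightConeInLawDoDPseudoDist
import Literature.MathematicalPhysics.KineticTheory.HardSphereEulerClassicalUniqueness

/-!
# The cone weight of the domain-of-dependence leg of the line `Sketch`
(crux `LightConeInLaw`, stmt-AtomisticToContinuum-12500, `--supports`; route `RelayRaceLocality`,
sub-problem `HydrodynamicLimit`; lead c1)

First of three files proving the FINITE DOMAIN OF DEPENDENCE of classical hard-sphere Euler
solutions on `𝕋³` (Dafermos 2005, Ch. V, Thm 5.2.1, cone form (5.2.1), classical-vs-classical,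
by the weighted relative-energy method) — the PDE hypothesis (DoD) of
`Sandwich.stub_core_of_hydroLimitGeneral_of_coneUniqueness`:

* `torus_weighted_energy_eq_zero` (registered) — the abstract WEIGHTED Grönwall shell: the tree's
  unweighted shell `HsEulerCalc.torus_energy_eq_zero_of_balance` applied to `(w e, w Φ)` given the
  TRANSPORT INEQUALITY `(∂ₜw) e + Σᵢ (∂ᵢw) Φᵢ ≤ 0` of the weight against the fluxes (Dafermos'
  Lipschitz test function, in smooth form);
* the cone weight `w(t, x) = expNegInvGlue((a₀ - κt)² - Q_y(x))` over the globally smooth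
  pseudo-distance `Q_y(x) = Σᵢ sin²(π‖(x - y)ᵢ‖)` of the flat torus (`4 dist² ≤ Q_y`,
  `|∇Q_y|² ≤ 4π² Q_y`, stubs of `…DoDPseudoDist.lean`): smoothness (`coneWeight_smooth`), time and
  space derivatives, and the transport inequality `coneWeight_transport` for `κ = π s` when the
  fluxes are dominated, `|ν · Φ| ≤ ‖ν‖ s e`.

Reference: C. M. Dafermos, *Hyperbolic Conservation Laws in Continuum Physics*, 2nd ed. (2005),
§5.2, Thm 5.2.1, (5.2.5)–(5.2.6). [Dafermos2005]
-/

namespace Summit.AtomisticToContinuum.HydrodynamicLimit.Theorems.LightConeInLawSketch.DoD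

open scoped BigOperators Topology Classical ENNReal
open Filter Set MeasureTheory
open Literature.MathematicalPhysics.KineticTheory Literature.Analysis.FluidPDE
  Literature.Analysis.FunctionSpaces

noncomputable section

open HsEulerCalc

/-! ### The weighted Grönwall shell on `[0, T) × 𝕋³` -/

/-- **Weighted energy method on the torus, abstract shell.** Let `e ≥ 0` (energy density),
`Φ₀, Φ₁, Φ₂` (fluxes) and `w ≥ 0` (weight) be jointly smooth scalar fields on `[0, T) × 𝕋³` with
`w(0,·) e(0,·) = 0`, the balance `∂ₜe + Σᵢ ∂ᵢΦᵢ ≤ C e` on every compact slab `[0, t₁] × 𝕋³`, and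
the TRANSPORT INEQUALITY of the weight against the fluxes, `(∂ₜw) e + Σᵢ (∂ᵢw) Φᵢ ≤ 0`
pointwise. Then `w e ≡ 0` on `[0, T) × 𝕋³`: the weighted pair `(w e, w Φ)` satisfies the
hypotheses of the unweighted shell `torus_energy_eq_zero_of_balance`, because
`∂ₜ(we) + Σᵢ∂ᵢ(wΦᵢ) = w (∂ₜe + Σᵢ∂ᵢΦᵢ) + [(∂ₜw) e + Σᵢ(∂ᵢw)Φᵢ] ≤ w · C e`. This is the
localisation device of Dafermos 2005, Thm 5.2.1 (the Lipschitz test function `ψ` of its proof),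
in smooth form. -/
theorem torus_weighted_energy_eq_zero :
    ∀ {T : ℝ} {e w : ℝ → T3 → ℝ} {Φ : Fin 3 → ℝ → T3 → ℝ},
    Torus.IsSmoothSpaceTimeOn (Ico 0 T) e → (∀ i, Torus.IsSmoothSpaceTimeOn (Ico 0 T) (Φ i)) →
    Torus.IsSmoothSpaceTimeOn (Ico 0 T) w →
    (∀ t ∈ Ico 0 T, ∀ x, 0 ≤ e t x) → (∀ t ∈ Ico 0 T, ∀ x, 0 ≤ w t x) →
    (∀ x, w 0 x * e 0 x = 0) →
    (∀ t₁ ∈ Ico 0 T, ∃ C : ℝ, ∀ t ∈ Icc 0 t₁, ∀ x,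
      Torus.timeDerivWithin (Ico 0 T) e t x + ∑ i, Torus.partialDeriv i (Φ i t) x ≤ C * e t x) →
    (∀ t ∈ Ico 0 T, ∀ x,
      Torus.timeDerivWithin (Ico 0 T) w t x * e t x +
        ∑ i, Torus.partialDeriv i (w t) x * Φ i t x ≤ 0) →
    ∀ t ∈ Ico 0 T, ∀ x, w t x * e t x = 0 := by
  intro T e w Φ he hΦ hw he0 hw0 hinit hbal hwt
  have hU : UniqueDiffOn ℝ (Ico (0 : ℝ) T) := uniqueDiffOn_Ico 0 T
  refine torus_energy_eq_zero_of_balance (e := fun t x => w t x * e t x)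
    (Φ := fun i t x => w t x * Φ i t x) (hw.mul he) (fun i => hw.mul (hΦ i))
    (fun t ht x => mul_nonneg (hw0 t ht x) (he0 t ht x)) hinit ?_
  intro t₁ ht₁
  obtain ⟨C, hC⟩ := hbal t₁ ht₁
  refine ⟨C, fun t ht x => ?_⟩
  have htT : t ∈ Ico 0 T := ⟨ht.1, ht.2.trans_lt ht₁.2⟩
  -- product rule in time
  have hte : Torus.timeDerivWithin (Ico 0 T) (fun s y => w s y * e s y) t x =
      Torus.timeDerivWithin (Ico 0 T) w t x * e t x + w t x * Torus.timeDerivWithin (Ico 0 T) e t x :=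
    timeDerivWithin_eq_of_hasDerivWithinAt
      ((hw.hasDerivWithinAt_slice htT x).mul (he.hasDerivWithinAt_slice htT x)) (hU t htT)
  -- product rule in space
  have hw1 : Torus.IsContDiff 1 (w t) := (hw.isSmooth_slice htT).isContDiff (by simp)
  have hsp : ∀ i, Torus.partialDeriv i (fun y => w t y * Φ i t y) x =
      w t x * Torus.partialDeriv i (Φ i t) x + Torus.partialDeriv i (w t) x * Φ i t x := fun i =>
    Torus.partialDeriv_mul hw1 (((hΦ i).isSmooth_slice htT).isContDiff (by simp)) i x
  have hsum : ∑ i, Torus.partialDeriv i (fun y => w t y * Φ i t y) x =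
      w t x * ∑ i, Torus.partialDeriv i (Φ i t) x +
        ∑ i, Torus.partialDeriv i (w t) x * Φ i t x := by
    rw [Finset.mul_sum, ← Finset.sum_add_distrib]
    exact Finset.sum_congr rfl fun i _ => hsp i
  have hmain := mul_le_mul_of_nonneg_left (hC t ht x) (hw0 t htT x)
  have hwt' := hwt t htT x
  calc Torus.timeDerivWithin (Ico 0 T) (fun s y => w s y * e s y) t x +
        ∑ i, Torus.partialDeriv i (fun y => w t y * Φ i t y) x
      = w t x * (Torus.timeDerivWithin (Ico 0 T) e t x + ∑ i, Torus.partialDeriv i (Φ i t) x) +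
        (Torus.timeDerivWithin (Ico 0 T) w t x * e t x +
          ∑ i, Torus.partialDeriv i (w t) x * Φ i t x) := by rw [hte, hsum]; ring
    _ ≤ w t x * (C * e t x) + 0 := add_le_add hmain hwt'
    _ = C * (w t x * e t x) := by ring


/-! ### The cone weight `w(t, x) = ψ((a₀ - κt)² - Q_y(x))`, `ψ = expNegInvGlue`,
`Q_y(x) = Σᵢ sin²(π ‖(x - y)ᵢ‖)` (globally smooth pseudo-distance on `𝕋³`) -/

/-- The derivative of `expNegInvGlue` vanishes on the closed half-line `(-∞, 0]`… more precisely
at every NEGATIVE point, where the function is locally zero. -/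
theorem deriv_expNegInvGlue_eq_zero_of_neg {g : ℝ} (hg : g < 0) : deriv expNegInvGlue g = 0 := by
  have h : expNegInvGlue =ᶠ[𝓝 g] fun _ => (0 : ℝ) := by
    filter_upwards [Iio_mem_nhds hg] with z hz using expNegInvGlue.zero_of_nonpos (le_of_lt hz)
  rw [h.deriv_eq, deriv_const]

/-- `expNegInvGlue` is differentiable (it is `C^∞`). -/
theorem differentiable_expNegInvGlue : Differentiable ℝ expNegInvGlue :=
  (expNegInvGlue.contDiff (n := 1)).differentiable (by simp)

/-- The cone weight is jointly smooth on every time set (the pseudo-distance is smooth on the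
whole torus, `isSmooth_qdist`, and `expNegInvGlue` is smooth). -/
theorem coneWeight_smooth (y : T3) (a₀ κ : ℝ) (S : Set ℝ) :
    Torus.IsSmoothSpaceTimeOn S (fun (t : ℝ) (x : T3) => expNegInvGlue
      ((a₀ - κ * t) ^ 2 - ∑ i : Fin 3, Real.sin (Real.pi * ‖(x - y) i‖) ^ 2)) := by
  refine Torus.isSmoothSpaceTimeOn_of_contDiff ?_ S
  have hQ := isSmooth_qdist y
  have h1 : ContDiff ℝ (⊤ : ℕ∞) (fun p : ℝ × EuclideanSpace ℝ (Fin 3) => (a₀ - κ * p.1) ^ 2 -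
      Torus.lift (fun x : T3 => ∑ i : Fin 3, Real.sin (Real.pi * ‖(x - y) i‖) ^ 2) p.2) :=
    ((contDiff_const.sub (contDiff_const.mul contDiff_fst)).pow 2).sub (hQ.comp contDiff_snd)
  exact expNegInvGlue.contDiff.comp h1

/-- The cone weight is nonnegative. -/
theorem coneWeight_nonneg (y : T3) (a₀ κ t : ℝ) (x : T3) :
    0 ≤ expNegInvGlue ((a₀ - κ * t) ^ 2 - ∑ i : Fin 3, Real.sin (Real.pi * ‖(x - y) i‖) ^ 2) :=
  expNegInvGlue.nonneg _

/-- Time derivative of the cone weight (chain rule). -/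
theorem coneWeight_hasDerivAt_time (y : T3) (a₀ κ t : ℝ) (x : T3) :
    HasDerivAt (fun τ : ℝ => expNegInvGlue
        ((a₀ - κ * τ) ^ 2 - ∑ i : Fin 3, Real.sin (Real.pi * ‖(x - y) i‖) ^ 2))
      (deriv expNegInvGlue ((a₀ - κ * t) ^ 2 - ∑ i : Fin 3, Real.sin (Real.pi * ‖(x - y) i‖) ^ 2) *
        (2 * (a₀ - κ * t) * (-κ))) t := by
  have h1 : HasDerivAt (fun τ : ℝ => a₀ - κ * τ) (-κ) t := by
    simpa using ((hasDerivAt_id t).const_mul κ).const_sub a₀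
  have h2 : HasDerivAt (fun τ : ℝ => (a₀ - κ * τ) ^ 2 -
      ∑ i : Fin 3, Real.sin (Real.pi * ‖(x - y) i‖) ^ 2) (2 * (a₀ - κ * t) * (-κ)) t := by
    have := (h1.pow 2).sub_const (∑ i : Fin 3, Real.sin (Real.pi * ‖(x - y) i‖) ^ 2)
    simpa using this
  exact ((differentiable_expNegInvGlue _).hasDerivAt).comp t h2

/-- The one-sided time derivative of the cone weight at a point of unique differentiability. -/
theorem coneWeight_timeDerivWithin (y : T3) (a₀ κ : ℝ) {S : Set ℝ} {t : ℝ}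
    (hS : UniqueDiffWithinAt ℝ S t) (x : T3) :
    Torus.timeDerivWithin S (fun (τ : ℝ) (x : T3) => expNegInvGlue
        ((a₀ - κ * τ) ^ 2 - ∑ i : Fin 3, Real.sin (Real.pi * ‖(x - y) i‖) ^ 2)) t x =
      deriv expNegInvGlue ((a₀ - κ * t) ^ 2 - ∑ i : Fin 3, Real.sin (Real.pi * ‖(x - y) i‖) ^ 2) *
        (2 * (a₀ - κ * t) * (-κ)) :=
  timeDerivWithin_eq_of_hasDerivWithinAt (coneWeight_hasDerivAt_time y a₀ κ t x).hasDerivWithinAt hS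

/-- Space derivatives of the cone weight (chain rule along coordinate lines,
`hasDerivAt_qdist_coordLine`). -/
theorem coneWeight_partialDeriv (y : T3) (a₀ κ t : ℝ) (x : T3) (i : Fin 3) :
    Torus.partialDeriv i (fun x : T3 => expNegInvGlue
        ((a₀ - κ * t) ^ 2 - ∑ i : Fin 3, Real.sin (Real.pi * ‖(x - y) i‖) ^ 2)) x =
      deriv expNegInvGlue ((a₀ - κ * t) ^ 2 - ∑ i : Fin 3, Real.sin (Real.pi * ‖(x - y) i‖) ^ 2) *
        (-(Real.pi * Real.sin (2 * Real.pi * Torus.reprSym (x - y) i))) := by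
  apply partialDeriv_eq_of_hasDerivAt
  have h2 := (hasDerivAt_qdist_coordLine y x i).const_sub ((a₀ - κ * t) ^ 2)
  have h3 := ((differentiable_expNegInvGlue _).hasDerivAt).comp (0 : ℝ) h2
  simpa only [Function.comp_def, zero_smul, Torus.proj_zero, add_zero] using h3

/-- **The transport inequality of the cone weight.** With `κ = π s`, `0 ≤ s`, `π s t ≤ a₀`, an
energy `e ≥ 0` and flux components dominated by `|ν · Φ| ≤ ‖ν‖ s e` for every `ν`, the weight
`w = ψ((a₀ - κ t)² - Q_y)` satisfies `(∂ₜw) e + Σᵢ (∂ᵢw) Φᵢ ≤ 0` pointwise: where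
`(a₀ - κt)² - Q_y < 0` the derivative of `ψ = expNegInvGlue` vanishes; elsewhere `ψ' ≥ 0` and
`|∇Q_y · Φ| ≤ ‖∇Q_y‖ s e ≤ 2π √Q_y s e ≤ 2π s (a₀ - κt) e = -(∂ₜ of the argument) e`. -/
theorem coneWeight_transport {y : T3} {a₀ s t : ℝ} {x : T3} (hs : 0 ≤ s)
    (ht : Real.pi * s * t ≤ a₀) {e : ℝ} (he : 0 ≤ e) {Φ : Fin 3 → ℝ}
    (hflux : ∀ ν : Fin 3 → ℝ, |∑ i, ν i * Φ i| ≤ Real.sqrt (∑ i, ν i ^ 2) * s * e) :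
    deriv expNegInvGlue ((a₀ - Real.pi * s * t) ^ 2 -
          ∑ i : Fin 3, Real.sin (Real.pi * ‖(x - y) i‖) ^ 2) *
        (2 * (a₀ - Real.pi * s * t) * (-(Real.pi * s))) * e +
      ∑ i, deriv expNegInvGlue ((a₀ - Real.pi * s * t) ^ 2 -
          ∑ i : Fin 3, Real.sin (Real.pi * ‖(x - y) i‖) ^ 2) *
        (-(Real.pi * Real.sin (2 * Real.pi * Torus.reprSym (x - y) i))) * Φ i ≤ 0 := by
  set Q : ℝ := ∑ i : Fin 3, Real.sin (Real.pi * ‖(x - y) i‖) ^ 2 with hQ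
  set g : ℝ := (a₀ - Real.pi * s * t) ^ 2 - Q with hg
  set D : Fin 3 → ℝ := fun i => Real.pi * Real.sin (2 * Real.pi * Torus.reprSym (x - y) i) with hD
  have hsum : ∑ i, deriv expNegInvGlue g * (-(D i)) * Φ i = -(deriv expNegInvGlue g * ∑ i, D i * Φ i) := by
    rw [Finset.mul_sum, ← Finset.sum_neg_distrib]
    exact Finset.sum_congr rfl fun i _ => by ring
  have hrew : deriv expNegInvGlue g * (2 * (a₀ - Real.pi * s * t) * (-(Real.pi * s))) * e +
      ∑ i, deriv expNegInvGlue g * (-(D i)) * Φ i =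
      deriv expNegInvGlue g * (-(2 * (Real.pi * s) * (a₀ - Real.pi * s * t) * e) - ∑ i, D i * Φ i) := by
    rw [hsum]
    ring
  show deriv expNegInvGlue g * (2 * (a₀ - Real.pi * s * t) * (-(Real.pi * s))) * e +
      ∑ i, deriv expNegInvGlue g * (-(D i)) * Φ i ≤ 0
  rw [hrew]
  rcases lt_or_ge g 0 with hneg | hnonneg
  · rw [deriv_expNegInvGlue_eq_zero_of_neg hneg, zero_mul]
  · have hψ : 0 ≤ deriv expNegInvGlue g := expNegInvGlue.monotone.deriv_nonneg
    have hQ0 : 0 ≤ Q := Finset.sum_nonneg fun i _ => sq_nonneg _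
    have hat : 0 ≤ a₀ - Real.pi * s * t := by linarith
    -- `√Q ≤ a₀ - π s t`
    have hsqrtQ : Real.sqrt Q ≤ a₀ - Real.pi * s * t := by
      rw [Real.sqrt_le_left hat]
      linarith [hnonneg]
    -- `‖D‖ ≤ 2π √Q`
    have hDn : Real.sqrt (∑ i, D i ^ 2) ≤ 2 * Real.pi * Real.sqrt Q := by
      have h4 : ∑ i, D i ^ 2 ≤ 4 * Real.pi ^ 2 * Q := sum_sq_partialDeriv_qdist_le x y
      calc Real.sqrt (∑ i, D i ^ 2) ≤ Real.sqrt (4 * Real.pi ^ 2 * Q) := Real.sqrt_le_sqrt h4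
        _ = 2 * Real.pi * Real.sqrt Q := by
          rw [Real.sqrt_mul (by positivity), Real.sqrt_mul (by positivity), Real.sqrt_sq Real.pi_pos.le,
            show (4 : ℝ) = 2 ^ 2 by norm_num, Real.sqrt_sq (by norm_num : (0 : ℝ) ≤ 2)]
    have hfl := hflux D
    have hbr : -(∑ i, D i * Φ i) ≤ 2 * (Real.pi * s) * (a₀ - Real.pi * s * t) * e := by
      have h1 : -(∑ i, D i * Φ i) ≤ Real.sqrt (∑ i, D i ^ 2) * s * e :=
        (neg_le_abs _).trans hfl
      have h2 : Real.sqrt (∑ i, D i ^ 2) * s * e ≤ 2 * Real.pi * Real.sqrt Q * s * e :=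
        mul_le_mul_of_nonneg_right (mul_le_mul_of_nonneg_right hDn hs) he
      have h3 : 2 * Real.pi * Real.sqrt Q * s * e ≤ 2 * Real.pi * (a₀ - Real.pi * s * t) * s * e :=
        mul_le_mul_of_nonneg_right (mul_le_mul_of_nonneg_right
          (mul_le_mul_of_nonneg_left hsqrtQ (by positivity)) hs) he
      linarith
    have hbr' : -(2 * (Real.pi * s) * (a₀ - Real.pi * s * t) * e) - ∑ i, D i * Φ i ≤ 0 := by linarith
    exact mul_nonpos_iff.2 (Or.inl ⟨hψ, hbr'⟩)

end

end Summit.AtomisticToContinuum.HydrodynamicLimit.Theorems.LightConeInLawSketch.DoD
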